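import Summits.ValiantsHypothesis.ValiantsHypothesis.Theorems.LacunarySymmetroidMatrixDescartesCensusDoorA34SheetWindowGramSign

/-!
# `MatrixDescartes` census — DOOR A at `(3,4)`: the HERMITIAN ORIENTATION LAW (window supports) — a six-nomial `T·L − A² − B²` of four real trinomials with
# five positive roots is NEGATIVE at `0⁺` and POSITIVE beyond its largest root; the semidefinite cell's middle block at EVERY scale ratio

HONEST FRAMING.  Object-search cell `pub-symmetroid`, engine seat `val-sym-eng-2` (g11); helper row beside the registered strata line
`Cruxes/DoorA34/Lines/strata.lean` on stmt-ValiantsHypothesis-19980 (`DoorA34 = PosRootLawAt 3 4 18`: OPEN, typed, never asserted here).  The predecessor seat's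
kernel ORIENTATION LAW (`Census.orientation_law`, …SheetWindowGramOrientationLaw) covers determinants of real SYMMETRIC three-letter `2 × 2` pencils, i.e.
six-nomials `T·L − A²` (`T, L, A` trinomials on `(0, d₁, d₂)`); its one realisability input is `det[polar Gram] = (det M)²/4 ≥ 0`.  On the `(3,4)` null-top
sheet the middle block of the SEMIDEFINITE inertia cell is NOT of that form unless the top letter is two-scale: in the normal form `S₃ = diag(α, β, 0)`,
`α, β ≥ 0`, it is `α·adj F₀₀ + β·adj F₁₁ = F₂₂·(αF₁₁ + βF₀₀) − (√α·F₁₂)² − (√β·F₀₂)²` — a six-nomial `T·L − A² − B²` of FOUR trinomials, the determinant of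
a `2 × 2` HERMITIAN pencil `[[T, A + iB], [A − iB, L]]`, whose Gram matrix lives in Minkowski signature `(1,3)` and CAN have negative determinant (a space-like
letter triple — but then the six-nomial is negative everywhere).  This file proves the law for that class, with an elementary replacement of the realisability square:

* `hermitianGram_det_nonneg_of_root` — if `T·L − A² − B²` VANISHES at some point `(1, u, v)` of the letter coordinates (e.g. at a root `x`, `u = x^{d₁}`,
  `v = x^{d₂}`), then its Gram determinant is `≥ 0`.  Proof: with the null vector `n = g₀ + u·g₁ + v·g₂` (unimodular change of basis) the Gram determinant equals
  `−⟨w, w⟩` for `w = ⟨n, g₁⟩·g₂ − ⟨n, g₂⟩·g₁ ⊥ n`, and a vector Minkowski-orthogonal to a non-zero null vector is space-like or null (Cauchy–Schwarz in `ℝ³`);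
  all of it is two polynomial identities and one `nlinarith`.
* **`orientation_law_hermitian`** — `T, L, A, B` real trinomials on `(0, d₁, d₂)` with `0 < d₁`, `2d₁ < d₂`; if `T·L − A² − B²` has at least FIVE distinct positive
  roots then `t₀l₀ − a₀² − b₀² < 0`, `t₁l₁ − a₁² − b₁² < 0` and `0 < t₂l₂ − a₂² − b₂²` (the predecessor's interpolation argument verbatim, fed by the lemma above
  instead of the realisability square); `hermitian_pos_beyond_roots`: the six-nomial is POSITIVE at every point beyond all its real roots, so `T` and `L` do not
  vanish there (`trinomials_ne_zero_beyond_roots`).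
* the `(3,4)` reading — SEMIDEFINITE CELL, EVERY SCALE RATIO: five middle-block roots ⇒ no top-window root beyond them, with no hypothesis on the core's
  roots — is the companion file …CensusDoorA34SheetSemidefOrientation (`topWindow_ne_zero_beyond_semidef_middle_roots`).

Nothing here bounds the sheet in the kernel; `DoorA34` and the three stubs stay OPEN; registers unchanged (`ζ_sym(3,4) ∈ {18,19}`); nothing on `MatrixDescartes`
(stmt-ValiantsHypothesis-18050) or on `VP ≠ VNP` — VP≠VNP not moved.  [folklore] Minkowski Cauchy–Schwarz; linear algebra of interpolation; Descartes' rule.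
-/

-- `Summit.ValiantsHypothesis.ValiantsHypothesis.…` repeats a component by the D-0017 layout
-- (single-conjunct summit), which the `dupNamespace` linter flags; the name is mandated.
set_option linter.dupNamespace false

namespace Summit.ValiantsHypothesis.ValiantsHypothesis.Theorems.LacunarySymmetroidMatrixDescartes.Census

open Summit.ValiantsHypothesis.ValiantsHypothesis.Theorems.SymmetroidDescartes (eval_det_pencil)
open scoped BigOperators Matrix
open Polynomial Finset

/-! ## 1. The Hermitian Gram inequality -/

/-- **HERMITIAN GRAM INEQUALITY.**  Let `gᵢ = (tᵢ, lᵢ, aᵢ, bᵢ)` (`i = 0,1,2`) be three vectors of `ℝ⁴` with the Minkowski form `⟨g, g'⟩ = (t l' + t' l)/2 − a a' − b b'`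
(the polarisation of `t·l − a² − b²`, signature `(1,3)`), and suppose the vector `n = g₀ + u·g₁ + v·g₂` is NULL: `⟨n, n⟩ = 0`.  Then the Gram determinant
`det[⟨gᵢ, gⱼ⟩]` — written out on the six coefficients `q₀ = ⟨g₀,g₀⟩, q₁ = 2⟨g₀,g₁⟩, q₂ = ⟨g₁,g₁⟩, q₃ = 2⟨g₀,g₂⟩, q₄ = 2⟨g₁,g₂⟩, q₅ = ⟨g₂,g₂⟩` of the six-nomial
`T·L − A² − B²` exactly as in `Census.card_posRoots_le_four_of_gram_det_eq_zero` — is NON-NEGATIVE.  (Unimodular change of basis to `(n, g₁, g₂)`: the determinant is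
`−⟨w,w⟩` with `w = ⟨n,g₁⟩g₂ − ⟨n,g₂⟩g₁`, `⟨n, w⟩ = 0`, and `⟨w,w⟩ ≤ 0` for a vector orthogonal to a null vector.) [folklore] -/
theorem hermitianGram_det_nonneg_of_root (t₀ t₁ t₂ l₀ l₁ l₂ a₀ a₁ a₂ b₀ b₁ b₂ u v : ℝ)
    (hroot : (t₀ + u * t₁ + v * t₂) * (l₀ + u * l₁ + v * l₂) - (a₀ + u * a₁ + v * a₂) ^ 2 - (b₀ + u * b₁ + v * b₂) ^ 2 = 0) :
    0 ≤ (t₀ * l₀ - a₀ ^ 2 - b₀ ^ 2) * (t₁ * l₁ - a₁ ^ 2 - b₁ ^ 2) * (t₂ * l₂ - a₂ ^ 2 - b₂ ^ 2)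
        + (t₀ * l₁ + t₁ * l₀ - 2 * a₀ * a₁ - 2 * b₀ * b₁) * (t₀ * l₂ + t₂ * l₀ - 2 * a₀ * a₂ - 2 * b₀ * b₂)
            * (t₁ * l₂ + t₂ * l₁ - 2 * a₁ * a₂ - 2 * b₁ * b₂) / 4
        - (t₀ * l₀ - a₀ ^ 2 - b₀ ^ 2) * (t₁ * l₂ + t₂ * l₁ - 2 * a₁ * a₂ - 2 * b₁ * b₂) ^ 2 / 4
        - (t₁ * l₁ - a₁ ^ 2 - b₁ ^ 2) * (t₀ * l₂ + t₂ * l₀ - 2 * a₀ * a₂ - 2 * b₀ * b₂) ^ 2 / 4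
        - (t₂ * l₂ - a₂ ^ 2 - b₂ ^ 2) * (t₀ * l₁ + t₁ * l₀ - 2 * a₀ * a₁ - 2 * b₀ * b₁) ^ 2 / 4 := by
  -- Gram entries γᵢⱼ = ⟨gᵢ, gⱼ⟩
  set γ₀₀ := t₀ * l₀ - a₀ ^ 2 - b₀ ^ 2 with hγ₀₀
  set γ₁₁ := t₁ * l₁ - a₁ ^ 2 - b₁ ^ 2 with hγ₁₁
  set γ₂₂ := t₂ * l₂ - a₂ ^ 2 - b₂ ^ 2 with hγ₂₂
  set γ₀₁ := (t₀ * l₁ + t₁ * l₀) / 2 - a₀ * a₁ - b₀ * b₁ with hγ₀₁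
  set γ₀₂ := (t₀ * l₂ + t₂ * l₀) / 2 - a₀ * a₂ - b₀ * b₂ with hγ₀₂
  set γ₁₂ := (t₁ * l₂ + t₂ * l₁) / 2 - a₁ * a₂ - b₁ * b₂ with hγ₁₂
  have hq1 : t₀ * l₁ + t₁ * l₀ - 2 * a₀ * a₁ - 2 * b₀ * b₁ = 2 * γ₀₁ := by rw [hγ₀₁]; ring
  have hq3 : t₀ * l₂ + t₂ * l₀ - 2 * a₀ * a₂ - 2 * b₀ * b₂ = 2 * γ₀₂ := by rw [hγ₀₂]; ring
  have hq4 : t₁ * l₂ + t₂ * l₁ - 2 * a₁ * a₂ - 2 * b₁ * b₂ = 2 * γ₁₂ := by rw [hγ₁₂]; ring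
  rw [hq1, hq3, hq4]
  -- the null vector n = g₀ + u g₁ + v g₂ and ν₁ = ⟨n, g₁⟩, ν₂ = ⟨n, g₂⟩
  set nt := t₀ + u * t₁ + v * t₂ with hnt
  set nl := l₀ + u * l₁ + v * l₂ with hnl
  set na := a₀ + u * a₁ + v * a₂ with hna
  set nb := b₀ + u * b₁ + v * b₂ with hnb
  set ν₁ := (nt * l₁ + nl * t₁) / 2 - na * a₁ - nb * b₁ with hν₁
  set ν₂ := (nt * l₂ + nl * t₂) / 2 - na * a₂ - nb * b₂ with hν₂
  have hnn : nt * nl - na ^ 2 - nb ^ 2 = γ₀₀ + 2 * u * γ₀₁ + 2 * v * γ₀₂ + u ^ 2 * γ₁₁ + 2 * u * v * γ₁₂ + v ^ 2 * γ₂₂ := by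
    rw [hnt, hnl, hna, hnb, hγ₀₀, hγ₀₁, hγ₀₂, hγ₁₁, hγ₁₂, hγ₂₂]; ring
  have hν₁γ : ν₁ = γ₀₁ + u * γ₁₁ + v * γ₁₂ := by rw [hν₁, hnt, hnl, hna, hnb, hγ₀₁, hγ₁₁, hγ₁₂]; ring
  have hν₂γ : ν₂ = γ₀₂ + u * γ₁₂ + v * γ₂₂ := by rw [hν₂, hnt, hnl, hna, hnb, hγ₀₂, hγ₁₂, hγ₂₂]; ring
  have hnull : nt * nl - na ^ 2 - nb ^ 2 = 0 := by rw [hnt, hnl, hna, hnb]; linarith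
  -- unimodular change of basis: det Gram(g₀,g₁,g₂) = ⟨n,n⟩·(γ₁₁γ₂₂ − γ₁₂²) − (ν₁²γ₂₂ − 2ν₁ν₂γ₁₂ + ν₂²γ₁₁)
  have key : γ₀₀ * γ₁₁ * γ₂₂ + 2 * γ₀₁ * (2 * γ₀₂) * (2 * γ₁₂) / 4 - γ₀₀ * (2 * γ₁₂) ^ 2 / 4 - γ₁₁ * (2 * γ₀₂) ^ 2 / 4
        - γ₂₂ * (2 * γ₀₁) ^ 2 / 4
      = (nt * nl - na ^ 2 - nb ^ 2) * (γ₁₁ * γ₂₂ - γ₁₂ ^ 2) - (ν₁ ^ 2 * γ₂₂ - 2 * ν₁ * ν₂ * γ₁₂ + ν₂ ^ 2 * γ₁₁) := by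
    rw [hnn, hν₁γ, hν₂γ]; ring
  rw [key, hnull, zero_mul, zero_sub]
  -- w = ν₁ g₂ − ν₂ g₁ has ⟨w,w⟩ = ν₁²γ₂₂ − 2ν₁ν₂γ₁₂ + ν₂²γ₁₁ and is Minkowski-orthogonal to n
  set wt := ν₁ * t₂ - ν₂ * t₁ with hwt
  set wl := ν₁ * l₂ - ν₂ * l₁ with hwl
  set wa := ν₁ * a₂ - ν₂ * a₁ with hwa
  set wb := ν₁ * b₂ - ν₂ * b₁ with hwb
  have hww : ν₁ ^ 2 * γ₂₂ - 2 * ν₁ * ν₂ * γ₁₂ + ν₂ ^ 2 * γ₁₁ = wt * wl - wa ^ 2 - wb ^ 2 := by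
    rw [hwt, hwl, hwa, hwb, hγ₁₁, hγ₁₂, hγ₂₂]; ring
  have horth : nt * wl + nl * wt = 2 * (na * wa + nb * wb) := by
    have e : nt * wl + nl * wt - 2 * (na * wa + nb * wb) = 2 * (ν₁ * ν₂ - ν₂ * ν₁) := by
      conv_rhs => rw [show ν₁ * ν₂ - ν₂ * ν₁ = ν₁ * ((nt * l₂ + nl * t₂) / 2 - na * a₂ - nb * b₂)
        - ν₂ * ((nt * l₁ + nl * t₁) / 2 - na * a₁ - nb * b₁) by rw [← hν₁, ← hν₂]]
      rw [hwt, hwl, hwa, hwb]; ring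
    have : ν₁ * ν₂ - ν₂ * ν₁ = 0 := by ring
    rw [this, mul_zero, sub_eq_zero] at e
    exact e
  rw [hww]
  have hnull' : nt * nl = na ^ 2 + nb ^ 2 := by linarith
  -- (na² + nb²)·(wa² + wb² − wt·wl) = (na·wb − nb·wa)² + (nt·wl − nl·wt)²/4 ≥ 0
  clear_value wt wl wa wb ν₁ ν₂ nt nl na nb
  have hid : (na ^ 2 + nb ^ 2) * (wa ^ 2 + wb ^ 2 - wt * wl) = (na * wb - nb * wa) ^ 2 + (nt * wl - nl * wt) ^ 2 / 4 := by
    have h1 : (na ^ 2 + nb ^ 2) * (wt * wl) = nt * nl * (wt * wl) := by rw [hnull']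
    have h2 : (nt * wl + nl * wt) ^ 2 = 4 * (na * wa + nb * wb) ^ 2 := by rw [horth]; ring
    linear_combination (-1 : ℝ) * h1 - (1 / 4 : ℝ) * h2
  by_cases hab : 0 < na ^ 2 + nb ^ 2
  · by_contra hneg
    have hlt : wa ^ 2 + wb ^ 2 - wt * wl < 0 := by linarith [lt_of_not_ge hneg]
    have hneg' : (na ^ 2 + nb ^ 2) * (wa ^ 2 + wb ^ 2 - wt * wl) < 0 := mul_neg_of_pos_of_neg hab hlt
    have hsq1 := sq_nonneg (na * wb - nb * wa)
    have hsq2 := sq_nonneg (nt * wl - nl * wt)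
    linarith only [hid, hneg', hsq1, hsq2]
  · have hab' : na ^ 2 + nb ^ 2 ≤ 0 := not_lt.1 hab
    have ha2 : na ^ 2 = 0 := le_antisymm (by linarith only [hab', sq_nonneg nb]) (sq_nonneg na)
    have hb2 : nb ^ 2 = 0 := le_antisymm (by linarith only [hab', sq_nonneg na]) (sq_nonneg nb)
    have ha : na = 0 := pow_eq_zero_iff (two_ne_zero) |>.1 ha2
    have hb : nb = 0 := pow_eq_zero_iff (two_ne_zero) |>.1 hb2
    have htl : nt * nl = 0 := by rw [hnull', ha, hb]; ring
    have horth' : nt * wl + nl * wt = 0 := by rw [horth, ha, hb]; ring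
    have hgoal : wt * wl = 0 → 0 ≤ -(wt * wl - wa ^ 2 - wb ^ 2) := fun h0 => by
      rw [h0]; linarith only [sq_nonneg wa, sq_nonneg wb]
    have hwν : ν₁ = 0 → ν₂ = 0 → 0 ≤ -(wt * wl - wa ^ 2 - wb ^ 2) := fun h1 h2 =>
      hgoal (by rw [hwt, h1, h2]; ring)
    rcases mul_eq_zero.1 htl with h | h
    · rw [h, zero_mul, zero_add] at horth'
      rcases mul_eq_zero.1 horth' with h' | h'
      · exact hwν (by rw [hν₁, h, h', ha, hb]; ring) (by rw [hν₂, h, h', ha, hb]; ring)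
      · exact hgoal (by rw [h', zero_mul])
    · rw [h, zero_mul, add_zero] at horth'
      rcases mul_eq_zero.1 horth' with h' | h'
      · exact hwν (by rw [hν₁, h, h', ha, hb]; ring) (by rw [hν₂, h, h', ha, hb]; ring)
      · exact hgoal (by rw [h', mul_zero])

/-! ## 2. The Hermitian orientation law -/

/-- The four-trinomial six-nomial `T·L − A² − B²` on `(0, d₁, d₂)` as `Σⱼ C qⱼ · X^{Eⱼ}` on the six pair sums. [folklore] -/
theorem hermitian_sixnomial_eq (d₁ d₂ : ℕ) (t₀ t₁ t₂ l₀ l₁ l₂ a₀ a₁ a₂ b₀ b₁ b₂ : ℝ) :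
    ((C t₀ + C t₁ * X ^ d₁ + C t₂ * X ^ d₂) * (C l₀ + C l₁ * X ^ d₁ + C l₂ * X ^ d₂)
        - (C a₀ + C a₁ * X ^ d₁ + C a₂ * X ^ d₂) ^ 2 - (C b₀ + C b₁ * X ^ d₁ + C b₂ * X ^ d₂) ^ 2 : ℝ[X])
      = C (t₀ * l₀ - a₀ ^ 2 - b₀ ^ 2) * X ^ 0 + C (t₀ * l₁ + t₁ * l₀ - 2 * a₀ * a₁ - 2 * b₀ * b₁) * X ^ d₁
        + C (t₁ * l₁ - a₁ ^ 2 - b₁ ^ 2) * X ^ (2 * d₁) + C (t₀ * l₂ + t₂ * l₀ - 2 * a₀ * a₂ - 2 * b₀ * b₂) * X ^ d₂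
        + C (t₁ * l₂ + t₂ * l₁ - 2 * a₁ * a₂ - 2 * b₁ * b₂) * X ^ (d₁ + d₂) + C (t₂ * l₂ - a₂ ^ 2 - b₂ ^ 2) * X ^ (2 * d₂) := by
  simp only [map_sub, map_add, map_mul, map_pow, map_ofNat]
  ring

/-- Evaluation of the four-trinomial six-nomial. [folklore] -/
theorem eval_hermitian_sixnomial (d₁ d₂ : ℕ) (t₀ t₁ t₂ l₀ l₁ l₂ a₀ a₁ a₂ b₀ b₁ b₂ x : ℝ) :
    ((C t₀ + C t₁ * X ^ d₁ + C t₂ * X ^ d₂) * (C l₀ + C l₁ * X ^ d₁ + C l₂ * X ^ d₂)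
        - (C a₀ + C a₁ * X ^ d₁ + C a₂ * X ^ d₂) ^ 2 - (C b₀ + C b₁ * X ^ d₁ + C b₂ * X ^ d₂) ^ 2 : ℝ[X]).eval x
      = (t₀ + x ^ d₁ * t₁ + x ^ d₂ * t₂) * (l₀ + x ^ d₁ * l₁ + x ^ d₂ * l₂)
        - (a₀ + x ^ d₁ * a₁ + x ^ d₂ * a₂) ^ 2 - (b₀ + x ^ d₁ * b₁ + x ^ d₂ * b₂) ^ 2 := by
  simp only [eval_sub, eval_add, eval_mul, eval_pow, eval_C, eval_X]
  ring

/-- **★ THE HERMITIAN ORIENTATION LAW (window supports).**  Let `T, L, A, B` be real trinomials on `(0, d₁, d₂)` with `0 < d₁`, `2d₁ < d₂` (coefficients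
`tᵢ, lᵢ, aᵢ, bᵢ`).  If `T·L − A² − B²` has at least FIVE distinct positive roots, then `t₀l₀ − a₀² − b₀² < 0`, `t₁l₁ − a₁² − b₁² < 0` and
`0 < t₂l₂ − a₂² − b₂²`: the Hermitian pencil `[[T, A + iB], [A − iB, L]]` is INDEFINITE at `0⁺` and DEFINITE beyond its largest root.  (Interpolation exactly as in
`Census.orientation_law`: the coefficient vector is `λ ×` the cofactor vector of five of the roots; `hermitianGram_det_nonneg_of_root` at one root and `peel_gramDet_pos`
force `λ > 0`; the signs are those of the cofactors, `genVandermonde_det_pos`.)  With `B = 0` this is the symmetric `2 × 2` law again, with a proof that does not use the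
realisability square. [folklore] -/
theorem orientation_law_hermitian (d₁ d₂ : ℕ) (hd₁ : 0 < d₁) (hw : 2 * d₁ < d₂) (t₀ t₁ t₂ l₀ l₁ l₂ a₀ a₁ a₂ b₀ b₁ b₂ : ℝ)
    (h5 : 5 ≤ ((((C t₀ + C t₁ * X ^ d₁ + C t₂ * X ^ d₂) * (C l₀ + C l₁ * X ^ d₁ + C l₂ * X ^ d₂)
        - (C a₀ + C a₁ * X ^ d₁ + C a₂ * X ^ d₂) ^ 2 - (C b₀ + C b₁ * X ^ d₁ + C b₂ * X ^ d₂) ^ 2 : ℝ[X])).roots.toFinset.filter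
          (fun t => 0 < t)).card) :
    t₀ * l₀ - a₀ ^ 2 - b₀ ^ 2 < 0 ∧ t₁ * l₁ - a₁ ^ 2 - b₁ ^ 2 < 0 ∧ 0 < t₂ * l₂ - a₂ ^ 2 - b₂ ^ 2 := by
  classical
  -- the six-nomial and its coefficient vector
  set E : Fin 6 → ℕ := ![0, d₁, 2 * d₁, d₂, d₁ + d₂, 2 * d₂] with hE
  have hEmono : StrictMono E := by
    refine Fin.strictMono_iff_lt_succ.2 fun i => ?_
    fin_cases i <;> simp [hE] <;> omega
  set q : Fin 6 → ℝ := ![t₀ * l₀ - a₀ ^ 2 - b₀ ^ 2, t₀ * l₁ + t₁ * l₀ - 2 * a₀ * a₁ - 2 * b₀ * b₁, t₁ * l₁ - a₁ ^ 2 - b₁ ^ 2,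
    t₀ * l₂ + t₂ * l₀ - 2 * a₀ * a₂ - 2 * b₀ * b₂, t₁ * l₂ + t₂ * l₁ - 2 * a₁ * a₂ - 2 * b₁ * b₂, t₂ * l₂ - a₂ ^ 2 - b₂ ^ 2] with hq
  set f : ℝ[X] := ((C t₀ + C t₁ * X ^ d₁ + C t₂ * X ^ d₂) * (C l₀ + C l₁ * X ^ d₁ + C l₂ * X ^ d₂)
        - (C a₀ + C a₁ * X ^ d₁ + C a₂ * X ^ d₂) ^ 2 - (C b₀ + C b₁ * X ^ d₁ + C b₂ * X ^ d₂) ^ 2 : ℝ[X]) with hf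
  have hfsum : f = ∑ j : Fin 6, C (q j) * X ^ E j := by
    rw [hf, hermitian_sixnomial_eq, Fin.sum_univ_six]; simp [hq, hE]
  have hfne : f ≠ 0 := by
    intro h0; rw [h0, roots_zero, Multiset.toFinset_zero, Finset.filter_empty, Finset.card_empty] at h5; omega
  -- five distinct positive roots, in increasing order
  obtain ⟨T, hTs, hTcard⟩ := Finset.exists_subset_card_eq h5
  set r : Fin 5 → ℝ := fun i => T.orderEmbOfFin hTcard i with hr
  have hrmono : StrictMono r := fun i j hij => (T.orderEmbOfFin hTcard).strictMono hij
  have hrmem : ∀ i, 0 < r i ∧ f.eval (r i) = 0 := by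
    intro i
    have hm := hTs (T.orderEmbOfFin_mem hTcard i)
    rw [Finset.mem_filter, Multiset.mem_toFinset, mem_roots hfne, IsRoot.def] at hm
    exact ⟨hm.2, hm.1⟩
  have hr0 : 0 < r 0 := (hrmem 0).1
  -- the cofactor vector κ and the minors D
  set D : Fin 6 → ℝ := fun j => (Matrix.of fun (i : Fin 5) (l : Fin 5) => r i ^ E (j.succAbove l)).det with hD
  set κ : Fin 6 → ℝ := fun j => (-1) ^ ((4 + 1) + (j : ℕ)) * D j with hκ
  have hDpos : ∀ j, 0 < D j := fun j =>
    genVandermonde_det_pos 4 r (fun l => E (j.succAbove l)) hrmono hr0 (hEmono.comp (Fin.strictMono_succAbove j))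
  -- both q and κ are annihilated by the node matrix
  have hWq : ∀ i, ∑ j, r i ^ E j * q j = 0 := by
    intro i
    have := (hrmem i).2
    rw [hfsum, eval_finsetSum] at this
    simp only [eval_mul, eval_C, eval_pow, eval_X] at this
    rw [← this]; exact Finset.sum_congr rfl fun j _ => mul_comm _ _
  have hWκ : ∀ i, ∑ j, r i ^ E j * κ j = 0 := by
    intro i
    have h := genVandermonde_det_eq_eval r E (r i)
    have hzero : (Matrix.of fun (i' : Fin 6) (j : Fin 6) => (Fin.snoc r (r i) : Fin 6 → ℝ) i' ^ E j).det = 0 := by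
      refine Matrix.det_zero_of_row_eq (i := Fin.castSucc i) (j := Fin.last 5) (Fin.castSucc_lt_last i).ne ?_
      ext j; simp only [Matrix.of_apply, Fin.snoc_castSucc, Fin.snoc_last]
    rw [hzero, eval_finsetSum] at h
    simp only [eval_mul, eval_C, eval_pow, eval_X] at h
    rw [h]; exact Finset.sum_congr rfl fun j _ => by simp only [hκ, hD]; ring
  -- q = λ • κ
  set lam : ℝ := q (Fin.last 5) / κ (Fin.last 5) with hlam
  have hκ5 : κ (Fin.last 5) = D (Fin.last 5) := by
    rw [hκ]; simp only [Fin.val_last]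
    rw [show (4 + 1 + 5 : ℕ) = 2 * 5 by norm_num, pow_mul, neg_one_sq, one_pow, one_mul]
  have hκ5ne : κ (Fin.last 5) ≠ 0 := by rw [hκ5]; exact (hDpos _).ne'
  have hv5 : q (Fin.last 5) - lam * κ (Fin.last 5) = 0 := by rw [hlam]; field_simp; ring
  have hv : ∀ j, q j - lam * κ j = 0 := by
    set v : Fin 5 → ℝ := fun l => q (Fin.castSucc l) - lam * κ (Fin.castSucc l) with hvdef
    have hW' : (Matrix.of fun (i : Fin 5) (l : Fin 5) => r i ^ E (Fin.castSucc l)) *ᵥ v = 0 := by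
      ext i
      simp only [Matrix.mulVec, dotProduct, Matrix.of_apply, Pi.zero_apply, hvdef]
      have h1 := hWq i; have h2 := hWκ i
      rw [Fin.sum_univ_castSucc] at h1 h2
      have hsplit : ∑ x : Fin 5, r i ^ E (Fin.castSucc x) * (q (Fin.castSucc x) - lam * κ (Fin.castSucc x))
          = (∑ x : Fin 5, r i ^ E (Fin.castSucc x) * q (Fin.castSucc x)) - lam * ∑ x : Fin 5, r i ^ E (Fin.castSucc x) * κ (Fin.castSucc x) := by
        rw [Finset.mul_sum, ← Finset.sum_sub_distrib]; exact Finset.sum_congr rfl fun x _ => by ring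
      rw [hsplit]
      linear_combination h1 - lam * h2 - (r i ^ E (Fin.last 5)) * hv5
    have hdet : (Matrix.of fun (i : Fin 5) (l : Fin 5) => r i ^ E (Fin.castSucc l)).det ≠ 0 :=
      genVandermonde_det_ne_zero r (fun l => E (Fin.castSucc l)) hrmono.injective (fun i => (hrmem i).1)
        (hEmono.comp Fin.strictMono_castSucc).injective
    have hv0 : v = 0 := Matrix.eq_zero_of_mulVec_eq_zero hdet hW'
    intro j
    induction j using Fin.lastCases with
    | last => exact hv5
    | cast l => have := congrFun hv0 l; simpa [hvdef] using this
  have hqκ : ∀ j, q j = lam * κ j := fun j => by linarith [hv j]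
  -- Gram determinants: det Q(q) ≥ 0 by the Hermitian Gram inequality at the root r 0, and det Q(q) = lam³ · det Q(κ) with det Q(κ) > 0
  have hroot0 : (t₀ + r 0 ^ d₁ * t₁ + r 0 ^ d₂ * t₂) * (l₀ + r 0 ^ d₁ * l₁ + r 0 ^ d₂ * l₂)
      - (a₀ + r 0 ^ d₁ * a₁ + r 0 ^ d₂ * a₂) ^ 2 - (b₀ + r 0 ^ d₁ * b₁ + r 0 ^ d₂ * b₂) ^ 2 = 0 := by
    rw [← eval_hermitian_sixnomial]; exact (hrmem 0).2
  have hgram_q : 0 ≤ q 0 * q 2 * q 5 + q 1 * q 3 * q 4 / 4 - q 0 * q 4 ^ 2 / 4 - q 2 * q 3 ^ 2 / 4 - q 5 * q 1 ^ 2 / 4 := by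
    have h := hermitianGram_det_nonneg_of_root t₀ t₁ t₂ l₀ l₁ l₂ a₀ a₁ a₂ b₀ b₁ b₂ (r 0 ^ d₁) (r 0 ^ d₂) hroot0
    simp only [hq, Matrix.cons_val_zero, Matrix.cons_val_one, Matrix.head_cons, Matrix.cons_val_two, Matrix.tail_cons]
    simp only [Fin.isValue, Matrix.cons_val]
    linarith [h]
  have hrvec : (![r 0, r 1, r 2, r 3, r 4] : Fin 5 → ℝ) = r := by ext i; fin_cases i <;> rfl
  have hD' : ∀ j : Fin 6, D j = (Matrix.of fun (i : Fin 5) (l : Fin 5) =>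
      (![r 0, r 1, r 2, r 3, r 4] : Fin 5 → ℝ) i ^ (![0, d₁, 2 * d₁, d₂, d₁ + d₂, 2 * d₂] : Fin 6 → ℕ) (j.succAbove l)).det := by
    intro j; rw [hrvec]
  have h01 : r 0 < r 1 := hrmono (show (0 : Fin 5) < 1 by decide)
  have h12 : r 1 < r 2 := hrmono (show (1 : Fin 5) < 2 by decide)
  have h23 : r 2 < r 3 := hrmono (show (2 : Fin 5) < 3 by decide)
  have h34 : r 3 < r 4 := hrmono (show (3 : Fin 5) < 4 by decide)
  have hpeel : 0 < D 0 * D 2 * D 5 - D 1 * D 3 * D 4 / 4 + D 0 * D 4 ^ 2 / 4 + D 2 * D 3 ^ 2 / 4 - D 5 * D 1 ^ 2 / 4 :=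
    peel_gramDet_pos d₁ d₂ hd₁ hw (r 0) (r 1) (r 2) (r 3) (r 4) hr0 h01 h12 h23 h34 D hD'
  have hQκ : κ 0 * κ 2 * κ 5 + κ 1 * κ 3 * κ 4 / 4 - κ 0 * κ 4 ^ 2 / 4 - κ 2 * κ 3 ^ 2 / 4 - κ 5 * κ 1 ^ 2 / 4
      = D 0 * D 2 * D 5 - D 1 * D 3 * D 4 / 4 + D 0 * D 4 ^ 2 / 4 + D 2 * D 3 ^ 2 / 4 - D 5 * D 1 ^ 2 / 4 := by
    simp only [hκ, show ((0 : Fin 6) : ℕ) = 0 from rfl, show ((1 : Fin 6) : ℕ) = 1 from rfl, show ((2 : Fin 6) : ℕ) = 2 from rfl,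
      show ((3 : Fin 6) : ℕ) = 3 from rfl, show ((4 : Fin 6) : ℕ) = 4 from rfl, show ((5 : Fin 6) : ℕ) = 5 from rfl]
    norm_num
    ring
  have hcube : q 0 * q 2 * q 5 + q 1 * q 3 * q 4 / 4 - q 0 * q 4 ^ 2 / 4 - q 2 * q 3 ^ 2 / 4 - q 5 * q 1 ^ 2 / 4
      = lam ^ 3 * (D 0 * D 2 * D 5 - D 1 * D 3 * D 4 / 4 + D 0 * D 4 ^ 2 / 4 + D 2 * D 3 ^ 2 / 4 - D 5 * D 1 ^ 2 / 4) := by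
    rw [← hQκ, hqκ 0, hqκ 1, hqκ 2, hqκ 3, hqκ 4, hqκ 5]; ring
  have hlam_nonneg : 0 ≤ lam := by
    have h3 : 0 ≤ lam ^ 3 := by
      by_contra hneg
      have : lam ^ 3 * (D 0 * D 2 * D 5 - D 1 * D 3 * D 4 / 4 + D 0 * D 4 ^ 2 / 4 + D 2 * D 3 ^ 2 / 4 - D 5 * D 1 ^ 2 / 4) < 0 :=
        mul_neg_of_neg_of_pos (lt_of_not_ge hneg) hpeel
      linarith [hgram_q, hcube]
    by_contra hneg
    have hl : lam < 0 := lt_of_not_ge hneg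
    have hl2 : 0 < lam ^ 2 := by rw [pow_two]; exact mul_pos_of_neg_of_neg hl hl
    have : lam ^ 3 < 0 := by rw [pow_succ]; exact mul_neg_of_pos_of_neg hl2 hl
    linarith
  have hlam_ne : lam ≠ 0 := by
    intro h0
    apply hfne
    rw [hfsum]
    refine Finset.sum_eq_zero fun j _ => ?_
    rw [hqκ j, h0, zero_mul, map_zero, zero_mul]
  have hlam_pos : 0 < lam := lt_of_le_of_ne hlam_nonneg (Ne.symm hlam_ne)
  -- the signs
  have hq0 : q 0 = t₀ * l₀ - a₀ ^ 2 - b₀ ^ 2 := rfl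
  have hq2 : q 2 = t₁ * l₁ - a₁ ^ 2 - b₁ ^ 2 := rfl
  have hq5 : q (Fin.last 5) = t₂ * l₂ - a₂ ^ 2 - b₂ ^ 2 := rfl
  have hκ0 : κ 0 = -D 0 := by rw [hκ]; simp only [show ((0 : Fin 6) : ℕ) = 0 from rfl]; norm_num
  have hκ2 : κ 2 = -D 2 := by rw [hκ]; simp only [show ((2 : Fin 6) : ℕ) = 2 from rfl]; norm_num
  refine ⟨?_, ?_, ?_⟩
  · rw [← hq0, hqκ 0, hκ0, mul_neg_iff]; exact Or.inl ⟨hlam_pos, neg_neg_of_pos (hDpos 0)⟩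
  · rw [← hq2, hqκ 2, hκ2, mul_neg_iff]; exact Or.inl ⟨hlam_pos, neg_neg_of_pos (hDpos 2)⟩
  · rw [← hq5, hqκ (Fin.last 5), hκ5]; exact mul_pos hlam_pos (hDpos _)

/-- **Positive beyond the roots.**  Under the hypotheses of `orientation_law_hermitian`, at every `x` exceeding all real roots of `T·L − A² − B²` the six-nomial is
POSITIVE: `T(x)·L(x) > A(x)² + B(x)²`. [folklore] -/
theorem hermitian_pos_beyond_roots (d₁ d₂ : ℕ) (hd₁ : 0 < d₁) (hw : 2 * d₁ < d₂) (t₀ t₁ t₂ l₀ l₁ l₂ a₀ a₁ a₂ b₀ b₁ b₂ : ℝ)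
    (h5 : 5 ≤ ((((C t₀ + C t₁ * X ^ d₁ + C t₂ * X ^ d₂) * (C l₀ + C l₁ * X ^ d₁ + C l₂ * X ^ d₂)
        - (C a₀ + C a₁ * X ^ d₁ + C a₂ * X ^ d₂) ^ 2 - (C b₀ + C b₁ * X ^ d₁ + C b₂ * X ^ d₂) ^ 2 : ℝ[X])).roots.toFinset.filter
          (fun t => 0 < t)).card)
    (x : ℝ) (hbeyond : ∀ z, (((C t₀ + C t₁ * X ^ d₁ + C t₂ * X ^ d₂) * (C l₀ + C l₁ * X ^ d₁ + C l₂ * X ^ d₂)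
        - (C a₀ + C a₁ * X ^ d₁ + C a₂ * X ^ d₂) ^ 2 - (C b₀ + C b₁ * X ^ d₁ + C b₂ * X ^ d₂) ^ 2 : ℝ[X])).IsRoot z → z < x) :
    (a₀ + x ^ d₁ * a₁ + x ^ d₂ * a₂) ^ 2 + (b₀ + x ^ d₁ * b₁ + x ^ d₂ * b₂) ^ 2
      < (t₀ + x ^ d₁ * t₁ + x ^ d₂ * t₂) * (l₀ + x ^ d₁ * l₁ + x ^ d₂ * l₂) := by
  classical
  obtain ⟨_, _, h2⟩ := orientation_law_hermitian d₁ d₂ hd₁ hw t₀ t₁ t₂ l₀ l₁ l₂ a₀ a₁ a₂ b₀ b₁ b₂ h5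
  set f : ℝ[X] := ((C t₀ + C t₁ * X ^ d₁ + C t₂ * X ^ d₂) * (C l₀ + C l₁ * X ^ d₁ + C l₂ * X ^ d₂)
        - (C a₀ + C a₁ * X ^ d₁ + C a₂ * X ^ d₂) ^ 2 - (C b₀ + C b₁ * X ^ d₁ + C b₂ * X ^ d₂) ^ 2 : ℝ[X]) with hf
  set E : Fin 6 → ℕ := ![0, d₁, 2 * d₁, d₂, d₁ + d₂, 2 * d₂] with hE
  have hEmono : StrictMono E := by
    refine Fin.strictMono_iff_lt_succ.2 fun i => ?_
    fin_cases i <;> simp [hE] <;> omega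
  set q : Fin 6 → ℝ := ![t₀ * l₀ - a₀ ^ 2 - b₀ ^ 2, t₀ * l₁ + t₁ * l₀ - 2 * a₀ * a₁ - 2 * b₀ * b₁, t₁ * l₁ - a₁ ^ 2 - b₁ ^ 2,
    t₀ * l₂ + t₂ * l₀ - 2 * a₀ * a₂ - 2 * b₀ * b₂, t₁ * l₂ + t₂ * l₁ - 2 * a₁ * a₂ - 2 * b₁ * b₂, t₂ * l₂ - a₂ ^ 2 - b₂ ^ 2] with hq
  have hfsum : f = ∑ j : Fin 6, C (q j) * X ^ E j := by
    rw [hf, hermitian_sixnomial_eq, Fin.sum_univ_six]; simp [hq, hE]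
  have hdeg := natDegree_leadingCoeff_sum_C_mul_X_pow q E hEmono (show q (Fin.last 5) ≠ 0 from h2.ne')
  rw [← hfsum] at hdeg
  have hdegpos : 0 < f.degree := by
    rw [hdeg.1]; exact_mod_cast (show 0 < E (Fin.last 5) by simp [hE]; omega)
  have hlc : 0 < f.leadingCoeff := by rw [hdeg.2]; exact h2
  have hfne : f ≠ 0 := fun h0 => by rw [h0, leadingCoeff_zero] at hlc; exact lt_irrefl _ hlc
  -- a point a < x beyond all roots
  obtain ⟨a, ha, hax⟩ : ∃ a, (∀ z, f.IsRoot z → z < a) ∧ a < x := by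
    by_cases hne : f.roots.toFinset.Nonempty
    · have hmx : f.roots.toFinset.max' hne < x :=
        hbeyond _ ((mem_roots hfne).1 (Multiset.mem_toFinset.1 (Finset.max'_mem _ hne)))
      refine ⟨(f.roots.toFinset.max' hne + x) / 2, fun z hz => ?_, by linarith⟩
      have hzm : z ≤ f.roots.toFinset.max' hne := Finset.le_max' _ _ (by rw [Multiset.mem_toFinset, mem_roots hfne]; exact hz)
      linarith
    · exact ⟨x - 1, fun z hz => absurd ⟨z, by rw [Multiset.mem_toFinset, mem_roots hfne]; exact hz⟩ hne, by linarith⟩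
  have hno : ∀ z, a < z → f.eval z ≠ 0 := fun z hz hfz => (lt_irrefl z) ((ha z hfz).trans hz)
  have hpos := leadingCoeff_mul_eval_pos_of_no_roots_beyond f hdegpos a hno x hax
  have hevalpos : 0 < f.eval x := pos_of_mul_pos_right hpos hlc.le
  rw [hf, eval_hermitian_sixnomial] at hevalpos
  linarith

/-- **No trinomial root beyond the five.**  Under the hypotheses of `orientation_law_hermitian`, beyond all real roots of `T·L − A² − B²` NEITHER `T` NOR `L`
vanishes (`T·L > A² + B² ≥ 0` there). [folklore] -/
theorem trinomials_ne_zero_beyond_roots (d₁ d₂ : ℕ) (hd₁ : 0 < d₁) (hw : 2 * d₁ < d₂) (t₀ t₁ t₂ l₀ l₁ l₂ a₀ a₁ a₂ b₀ b₁ b₂ : ℝ)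
    (h5 : 5 ≤ ((((C t₀ + C t₁ * X ^ d₁ + C t₂ * X ^ d₂) * (C l₀ + C l₁ * X ^ d₁ + C l₂ * X ^ d₂)
        - (C a₀ + C a₁ * X ^ d₁ + C a₂ * X ^ d₂) ^ 2 - (C b₀ + C b₁ * X ^ d₁ + C b₂ * X ^ d₂) ^ 2 : ℝ[X])).roots.toFinset.filter
          (fun t => 0 < t)).card)
    (x : ℝ) (hbeyond : ∀ z, (((C t₀ + C t₁ * X ^ d₁ + C t₂ * X ^ d₂) * (C l₀ + C l₁ * X ^ d₁ + C l₂ * X ^ d₂)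
        - (C a₀ + C a₁ * X ^ d₁ + C a₂ * X ^ d₂) ^ 2 - (C b₀ + C b₁ * X ^ d₁ + C b₂ * X ^ d₂) ^ 2 : ℝ[X])).IsRoot z → z < x) :
    t₀ + x ^ d₁ * t₁ + x ^ d₂ * t₂ ≠ 0 ∧ l₀ + x ^ d₁ * l₁ + x ^ d₂ * l₂ ≠ 0 := by
  have h := hermitian_pos_beyond_roots d₁ d₂ hd₁ hw t₀ t₁ t₂ l₀ l₁ l₂ a₀ a₁ a₂ b₀ b₁ b₂ h5 x hbeyond
  have hprod : 0 < (t₀ + x ^ d₁ * t₁ + x ^ d₂ * t₂) * (l₀ + x ^ d₁ * l₁ + x ^ d₂ * l₂) := by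
    nlinarith [sq_nonneg (a₀ + x ^ d₁ * a₁ + x ^ d₂ * a₂), sq_nonneg (b₀ + x ^ d₁ * b₁ + x ^ d₂ * b₂)]
  constructor
  · intro h0; rw [h0, zero_mul] at hprod; exact lt_irrefl _ hprod
  · intro h0; rw [h0, mul_zero] at hprod; exact lt_irrefl _ hprod
end Summit.ValiantsHypothesis.ValiantsHypothesis.Theorems.LacunarySymmetroidMatrixDescartes.Census
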